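import Mathlib.Analysis.SpecialFunctions.Exp
import Mathlib.Analysis.SpecialFunctions.Pow.Real
import Mathlib.Analysis.Complex.ExponentialBounds
import Mathlib.Analysis.Real.Pi.Bounds
import HarnessLib

/-!
# Route `CylinderEntropy`, item `ImmortalAreaToFloor` (stmt-SmoothPoincare4-17197):
# the numeric conditions of the stacking argument, term by term (module Γ6/Γ8 of
# `BLUEPRINT-17197-c2.md`, pure real arithmetic, part 1)

The stacking contradiction `noTwoGoodPoints` needs, for the gap `g` of two good points on one
vertical, scales `σ₀ = g²/C₀² ≤ σ₁ = Λ₁ g²`, a near radius `ρ = K_ρ g ≤ R₀`, an aperture `η`, an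
AM–GM parameter `κ`, a tilt threshold `ξ`, a Willmore threshold `θ` and a Willmore budget `W ≤ W₀`,
satisfying four numeric smallness conditions in which every contribution is either scale-free
(proportional to `ξ`, `1/κ`, `e^{-K_ρ²/(8Λ₁)}`, `e^{-K_ρ²/(16Λ₁)}`) or carries a positive power of `g`.
`exists_stackingParameters` chooses them in the order
`δ₀ ↦ (η, Λ₁) ↦ C₀² ↦ K_ρ ↦ κ ↦ ξ ↦ g_max`, `θ = π²/(4096 e^{1/16}(C_A+1))`, `W₀ = R₀⁴/2`
(so that `K_H = 2048 e^{1/16} θ C_A/π² + W/R₀⁴ ≤ 1`), polynomially (tails are bounded by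
`e^{-x} ≤ 1/x`), and verifies the conditions for all `0 < g ≤ g_max`, `0 ≤ W ≤ W₀`.

References: W. K. Allard, Ann. of Math. 95 (1972) §6 (the order of constants in the integrality
theorem); L. Simon, *Lectures on GMT* (1983) §17.
-/

-- the prescribed namespace `Summit.SmoothPoincare4.SmoothPoincare4.…` repeats `SmoothPoincare4`
set_option linter.dupNamespace false

noncomputable section

open Real

namespace Summit.SmoothPoincare4.SmoothPoincare4.Cruxes.CylinderRungTwo.KillingFlux

/-- `1 - 2η ≤ (1+η)⁻²` for `η ≥ 0`. [folklore] -/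
theorem one_sub_two_mul_le_inv_sq {η : ℝ} (hη : 0 ≤ η) : 1 - 2 * η ≤ (1 + η)⁻¹ ^ 2 := by
  have h1 : 0 < 1 + η := by linarith
  rw [inv_pow, ← one_div, le_div_iff₀ (by positivity)]
  nlinarith [sq_nonneg η, mul_nonneg hη (sq_nonneg η)]

/-! ### Algebraic identities of the cutoff-error bookkeeping (tiny contexts for `field_simp`) -/

/-- [folklore] -/
theorem alg_e2a (c₂ g C₀sq ξ CA Kρ Λ₁ : ℝ) (hg : g ≠ 0) (hC : C₀sq ≠ 0) :
    c₂ / g ^ 2 * ((1 / (4 * Real.pi * (g ^ 2 / C₀sq)) ^ 2) * (ξ * (CA * (Kρ * g) ^ 4))) * (Λ₁ * g ^ 2) =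
      c₂ * C₀sq ^ 2 * CA * Kρ ^ 4 * Λ₁ * ξ / (16 * Real.pi ^ 2) := by
  have hπ : Real.pi ≠ 0 := Real.pi_pos.ne'
  field_simp
  ring

/-- [folklore] -/
theorem alg_e2b (Kρ g Λ₁ : ℝ) (hg : g ≠ 0) (hΛ : Λ₁ ≠ 0) (a : ℝ) (ha : a ≠ 0) :
    -(Kρ * g) ^ 2 / (a * (Λ₁ * g ^ 2)) = -(Kρ ^ 2 / (a * Λ₁)) := by
  field_simp

/-- [folklore] -/
theorem alg_e2c (c₂ g E CG Λ₁ : ℝ) (hg : g ≠ 0) :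
    c₂ / g ^ 2 * (4 * E * CG) * (Λ₁ * g ^ 2) = 4 * c₂ * CG * Λ₁ * E := by
  field_simp

/-- [folklore] -/
theorem alg_e2d (c₂ CG Λ₁ Kρ : ℝ) (hK : Kρ ≠ 0) (hΛ : Λ₁ ≠ 0) :
    4 * c₂ * CG * Λ₁ * (1 / (Kρ ^ 2 / (8 * Λ₁))) = 32 * c₂ * CG * Λ₁ ^ 2 / Kρ ^ 2 := by
  field_simp
  ring

/-- [folklore] -/
theorem alg_e3 (c₁ g KH CG Λ₁ : ℝ) (hg : g ≠ 0) :
    c₁ / g * ((1 / 2) * KH + (1 / (2 * 1)) * CG) * (Λ₁ * g ^ 2) = c₁ * Λ₁ * g * (KH + CG) / 2 := by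
  field_simp

/-- [folklore] -/
theorem alg_e4a (g C₀sq c₁ Kρ κ ξ CA Λ₁ : ℝ) (hg : g ≠ 0) (hC : C₀sq ≠ 0) (hκ : κ ≠ 0) :
    (1 / (g ^ 2 / C₀sq)) * (c₁ / g * ((1 / (4 * Real.pi * (g ^ 2 / C₀sq)) ^ 2) * (Kρ * g) *
        ((κ / 2) * (ξ * (CA * (Kρ * g) ^ 4)) + CA * (Kρ * g) ^ 4 / (2 * κ)))) * (Λ₁ * g ^ 2) =
      c₁ * C₀sq ^ 3 * Kρ ^ 5 * CA * Λ₁ * κ * ξ / (32 * Real.pi ^ 2) +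
        c₁ * C₀sq ^ 3 * Kρ ^ 5 * CA * Λ₁ / (32 * Real.pi ^ 2 * κ) := by
  have hπ : Real.pi ≠ 0 := Real.pi_pos.ne'
  field_simp
  ring

/-- [folklore] -/
theorem alg_e4b (g C₀sq c₁ E₁ E₂ CG Λ₁ δ₀ : ℝ) (hg : g ≠ 0) (hC : C₀sq ≠ 0) (hδ : δ₀ ≠ 0) :
    (1 / (g ^ 2 / C₀sq)) * (c₁ / g * (32 * (16 * g / δ₀) * E₁ * E₂ * CG)) * (Λ₁ * g ^ 2) =
      512 * c₁ * C₀sq * Λ₁ / δ₀ * E₁ * E₂ * CG := by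
  field_simp
  ring

/-- [folklore] -/
theorem alg_e4d (c₁ C₀sq Λ₁ δ₀ Kρ CG : ℝ) (hδ : δ₀ ≠ 0) (hK : Kρ ≠ 0) (hΛ : Λ₁ ≠ 0) :
    512 * c₁ * C₀sq * Λ₁ / δ₀ * 1 * (1 / (Kρ ^ 2 / (16 * Λ₁))) * CG =
      8192 * c₁ * C₀sq * Λ₁ ^ 2 * CG / (δ₀ * Kρ ^ 2) := by
  field_simp
  ring

/-- [folklore] -/
theorem alg_e4e (c₁ C₀sq Λ₁ δ₀ CG : ℝ) (hδ : δ₀ ≠ 0) :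
    112 * 512 * c₁ * C₀sq * (16 / δ₀) * Λ₁ ^ 2 * CG / δ₀ =
      (8192 * c₁ * C₀sq * Λ₁ ^ 2 * CG * 112) / (δ₀ * δ₀) := by
  field_simp
  ring

/-! ### The four numeric conditions -/

/-- Condition `hm` for `η = δ₀/64`, `Λ₁ = 256/δ₀²`. [folklore] -/
theorem param_hm {δ₀ η Λ₁ g : ℝ} (hδ₀ : 0 < δ₀) (hδ₁ : δ₀ ≤ 1) (hη : η = δ₀ / 64)
    (hΛ₁ : Λ₁ = 256 / δ₀ ^ 2) (hg : 0 < g) :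
    1 - δ₀ / 8 ≤ (1 + η)⁻¹ ^ 2 * Real.exp (-((1 + η⁻¹) * (g / 2) ^ 2) / (4 * ((1 + η) * (Λ₁ * g ^ 2)))) := by
  have hη0 : 0 < η := by rw [hη]; positivity
  have hexp : -((1 + η⁻¹) * (g / 2) ^ 2) / (4 * ((1 + η) * (Λ₁ * g ^ 2))) = -(δ₀ / 64) := by
    have hηne : η ≠ 0 := hη0.ne'
    have h1ηne : 1 + η ≠ 0 := (by linarith only [hη0] : (0:ℝ) < 1 + η).ne'
    have hg0 : g ≠ 0 := hg.ne'
    have hδ : δ₀ ≠ 0 := hδ₀.ne'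
    rw [hΛ₁, div_eq_iff (by positivity)]
    field_simp
    rw [hη]
    ring
  rw [hexp]
  have h1 : 1 - 2 * η ≤ (1 + η)⁻¹ ^ 2 := one_sub_two_mul_le_inv_sq hη0.le
  have h2 : 1 - δ₀ / 64 ≤ Real.exp (-(δ₀ / 64)) := Real.one_sub_le_exp_neg _
  have h3 : 0 ≤ 1 - 2 * η := by rw [hη]; linarith only [hδ₁]
  have h4 : 0 ≤ 1 - δ₀ / 64 := by linarith only [hδ₁]
  calc 1 - δ₀ / 8 ≤ (1 - 2 * η) * (1 - δ₀ / 64) := by rw [hη]; nlinarith only [hδ₀, hδ₁]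
    _ ≤ (1 + η)⁻¹ ^ 2 * Real.exp (-(δ₀ / 64)) := mul_le_mul h1 h2 h4 (h3.trans h1)

/-- Condition `ha`. [folklore] -/
theorem param_ha {δ₀ KH C₀sq CG g : ℝ} (hδ₀ : 0 < δ₀) (hδ₁ : δ₀ ≤ 1) (hKH0 : 0 ≤ KH) (hKH1 : KH ≤ 1)
    (hCG : 0 ≤ CG) (hC₀sq : C₀sq = 1 + 27648 * (CG + 1) / δ₀) (hg : 0 < g)
    (hσ₀δ : g ^ 2 / C₀sq ≤ δ₀ / 64) :
    Real.exp (4 * (g ^ 2 / C₀sq)) * (KH / 4) * (g ^ 2 / C₀sq) +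
      4 * Real.exp (4 * (g ^ 2 / C₀sq)) * Real.exp (-g ^ 2 / (72 * (g ^ 2 / C₀sq))) * CG ≤ δ₀ / 16 := by
  have hC₀1 : 1 ≤ C₀sq := by
    have : (0:ℝ) ≤ 27648 * (CG + 1) / δ₀ := by positivity
    rw [hC₀sq]; linarith only [this]
  have hC₀0 : 0 < C₀sq := by linarith only [hC₀1]
  have hg0 : g ≠ 0 := hg.ne'
  have hCne : C₀sq ≠ 0 := hC₀0.ne'
  -- `e^x ≤ e ≤ 3` for `x ≤ 1`, and `e^{-x} ≤ 1/x` for `x > 0`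
  have hexpinv : ∀ x : ℝ, 0 < x → Real.exp (-x) ≤ 1 / x := fun x hx => by
    rw [Real.exp_neg, ← one_div]
    apply one_div_le_one_div_of_le hx
    have := Real.add_one_le_exp x; linarith
  have he3 : Real.exp (4 * (g ^ 2 / C₀sq)) ≤ 3 := by
    calc Real.exp (4 * (g ^ 2 / C₀sq)) ≤ Real.exp 1 := Real.exp_le_exp.2 (by linarith only [hσ₀δ, hδ₁])
      _ ≤ 3 := by
          have := Real.exp_one_lt_d9
          norm_num at this
          linarith
  have htail : Real.exp (-g ^ 2 / (72 * (g ^ 2 / C₀sq))) ≤ 1 / (C₀sq / 72) := by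
    have : -g ^ 2 / (72 * (g ^ 2 / C₀sq)) = -(C₀sq / 72) := by field_simp
    rw [this]; exact hexpinv _ (by positivity)
  have hσ0 : 0 ≤ g ^ 2 / C₀sq := by positivity
  have h1 : Real.exp (4 * (g ^ 2 / C₀sq)) * (KH / 4) * (g ^ 2 / C₀sq) ≤ 3 * (1 / 4) * (δ₀ / 64) :=
    mul_le_mul (mul_le_mul he3 (by linarith only [hKH1]) (by positivity) (by norm_num)) hσ₀δ hσ0
      (by norm_num)
  have h2 : 4 * Real.exp (4 * (g ^ 2 / C₀sq)) * Real.exp (-g ^ 2 / (72 * (g ^ 2 / C₀sq))) * CG ≤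
      4 * 3 * (1 / (C₀sq / 72)) * CG := by
    gcongr
  have h3 : 4 * 3 * (1 / (C₀sq / 72)) * CG = 864 * CG / C₀sq := by field_simp; ring
  have h4 : 864 * CG / C₀sq ≤ δ₀ / 32 := by
    rw [div_le_div_iff₀ hC₀0 (by norm_num)]
    have e : δ₀ * C₀sq = δ₀ + 27648 * (CG + 1) := by
      have hδ : δ₀ ≠ 0 := hδ₀.ne'
      rw [hC₀sq]; field_simp
    linarith only [e, hCG, hδ₀]
  rw [h3] at h2
  linarith only [h1, h2, h4, hδ₀]

/-- Condition `hK` (the cutoff-error constant times `σ₁`), from the scale-free smallness of each of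
its seven terms. [cite: Allard1972, §6] -/
theorem param_hK {δ₀ KH C₀sq CG CA c₁ c₂ Kρ κ ξ Λ₁ g : ℝ} (hδ₀ : 0 < δ₀) (hKH0 : 0 ≤ KH)
    (hKH1 : KH ≤ 1) (hCG : 0 ≤ CG) (hc₁ : 0 ≤ c₁) (hc₂ : 0 ≤ c₂) (hC₀0 : 0 < C₀sq)
    (hKρ1 : 1 ≤ Kρ) (hκ0 : 0 < κ) (hΛ₁0 : 0 < Λ₁) (hg : 0 < g)
    (hσ₁δ : Λ₁ * g ^ 2 ≤ δ₀ / 64)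
    (hsqrt : Real.sqrt (Λ₁ * g ^ 2) = 16 * g / δ₀)
    (hKa : 112 * 32 * c₂ * CG * Λ₁ ^ 2 / δ₀ ≤ Kρ)
    (hKb : 112 * 512 * c₁ * C₀sq * (16 / δ₀) * Λ₁ ^ 2 * CG / δ₀ ≤ Kρ)
    (hκa : 4 * c₁ * C₀sq ^ 3 * Kρ ^ 5 * CA * Λ₁ / δ₀ ≤ κ)
    (hξa : ξ * (16 * c₂ * C₀sq ^ 2 * CA * Kρ ^ 4 * Λ₁ / δ₀) ≤ 1)
    (hξb : ξ * (4 * c₁ * C₀sq ^ 3 * Kρ ^ 5 * CA * Λ₁ * κ / δ₀) ≤ 1)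
    (hgc : g * (128 * (c₁ + 1) * Λ₁ * (1 + CG) / δ₀) ≤ 1) :
    (KH / 4
      + c₂ / g ^ 2 *
        ((1 / (4 * Real.pi * (g ^ 2 / C₀sq)) ^ 2) * (ξ * (CA * (Kρ * g) ^ 4)) +
          4 * Real.exp (-(Kρ * g) ^ 2 / (8 * (Λ₁ * g ^ 2))) * CG)
      + c₁ / g * ((1 / 2) * KH + (1 / (2 * 1)) * CG)
      + (1 / (g ^ 2 / C₀sq)) * (c₁ / g *
        ((1 / (4 * Real.pi * (g ^ 2 / C₀sq)) ^ 2) * (Kρ * g) *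
            ((κ / 2) * (ξ * (CA * (Kρ * g) ^ 4)) + CA * (Kρ * g) ^ 4 / (2 * κ))
          + 32 * Real.sqrt (Λ₁ * g ^ 2) * Real.exp (-(1 / 2)) *
            Real.exp (-(Kρ * g) ^ 2 / (16 * (Λ₁ * g ^ 2))) * CG)))
      * (Λ₁ * g ^ 2) ≤ δ₀ / 16 := by
  have hπ := Real.pi_pos
  have hπ3 : 3 < Real.pi := Real.pi_gt_three
  have hπ2 : 1 ≤ Real.pi ^ 2 := by nlinarith only [hπ3]
  have hg0 : g ≠ 0 := hg.ne'
  have hCne : C₀sq ≠ 0 := hC₀0.ne'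
  have hKρ0 : 0 < Kρ := by linarith only [hKρ1]
  have hKne : Kρ ≠ 0 := hKρ0.ne'
  have hκne : κ ≠ 0 := hκ0.ne'
  have hΛne : Λ₁ ≠ 0 := hΛ₁0.ne'
  have hδne : δ₀ ≠ 0 := hδ₀.ne'
  have hK2 : Kρ ≤ Kρ ^ 2 := by nlinarith only [hKρ1]
  have hexpinv : ∀ x : ℝ, 0 < x → Real.exp (-x) ≤ 1 / x := fun x hx => by
    rw [Real.exp_neg, ← one_div]
    apply one_div_le_one_div_of_le hx
    have := Real.add_one_le_exp x; linarith
  -- group 1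
  have hS1 : KH / 4 * (Λ₁ * g ^ 2) ≤ δ₀ / 256 := by
    have : KH / 4 * (Λ₁ * g ^ 2) ≤ 1 / 4 * (δ₀ / 64) :=
      mul_le_mul (by linarith only [hKH1]) hσ₁δ (by positivity) (by norm_num)
    linarith only [this]
  -- group 2
  have hS2a : c₂ * C₀sq ^ 2 * CA * Kρ ^ 4 * Λ₁ * ξ / (16 * Real.pi ^ 2) ≤ δ₀ / 256 := by
    have hnum : 16 * (c₂ * C₀sq ^ 2 * CA * Kρ ^ 4 * Λ₁ * ξ) ≤ δ₀ := by
      have := mul_le_mul_of_nonneg_right hξa hδ₀.le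
      have e : ξ * (16 * c₂ * C₀sq ^ 2 * CA * Kρ ^ 4 * Λ₁ / δ₀) * δ₀ =
          16 * (c₂ * C₀sq ^ 2 * CA * Kρ ^ 4 * Λ₁ * ξ) := by field_simp
      rw [e, one_mul] at this
      exact this
    rw [div_le_div_iff₀ (by positivity) (by norm_num)]
    have h : 0 ≤ δ₀ * (Real.pi ^ 2 - 1) := mul_nonneg hδ₀.le (sub_nonneg.2 hπ2)
    linarith only [hnum, h]
  have hS2b : c₂ / g ^ 2 * (4 * Real.exp (-(Kρ * g) ^ 2 / (8 * (Λ₁ * g ^ 2))) * CG) * (Λ₁ * g ^ 2) ≤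
      δ₀ / 112 := by
    rw [alg_e2b Kρ g Λ₁ hg0 hΛne 8 (by norm_num), alg_e2c c₂ g _ CG Λ₁ hg0]
    have ht : Real.exp (-(Kρ ^ 2 / (8 * Λ₁))) ≤ 1 / (Kρ ^ 2 / (8 * Λ₁)) :=
      hexpinv _ (by positivity)
    have h1 : 4 * c₂ * CG * Λ₁ * Real.exp (-(Kρ ^ 2 / (8 * Λ₁))) ≤
        4 * c₂ * CG * Λ₁ * (1 / (Kρ ^ 2 / (8 * Λ₁))) := mul_le_mul_of_nonneg_left ht (by positivity)
    rw [alg_e2d c₂ CG Λ₁ Kρ hKne hΛne] at h1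
    have h2 : 32 * c₂ * CG * Λ₁ ^ 2 / Kρ ^ 2 ≤ δ₀ / 112 := by
      rw [div_le_div_iff₀ (by positivity) (by norm_num)]
      rw [div_le_iff₀ hδ₀] at hKa
      have h : δ₀ * Kρ ≤ δ₀ * Kρ ^ 2 := mul_le_mul_of_nonneg_left hK2 hδ₀.le
      linarith only [hKa, h]
    linarith only [h1, h2]
  -- group 3
  have hS3 : c₁ / g * ((1 / 2) * KH + (1 / (2 * 1)) * CG) * (Λ₁ * g ^ 2) ≤ δ₀ / 128 := by
    rw [alg_e3 c₁ g KH CG Λ₁ hg0]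
    have hΛg0 : 0 ≤ Λ₁ * g := by positivity
    have h1 : c₁ * Λ₁ * g * (KH + CG) ≤ (c₁ + 1) * Λ₁ * g * (1 + CG) :=
      mul_le_mul (by linarith only [hΛg0]) (by linarith only [hKH1]) (by positivity) (by positivity)
    have h2 : (c₁ + 1) * Λ₁ * g * (1 + CG) * 128 ≤ δ₀ := by
      have e' : g * (128 * (c₁ + 1) * Λ₁ * (1 + CG) / δ₀) * δ₀ = (c₁ + 1) * Λ₁ * g * (1 + CG) * 128 := by
        field_simp
      have := mul_le_mul_of_nonneg_right hgc hδ₀.le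
      rw [e', one_mul] at this
      exact this
    linarith only [h1, h2, hδ₀]
  -- group 4
  have hS4a : c₁ * C₀sq ^ 3 * Kρ ^ 5 * CA * Λ₁ * κ * ξ / (32 * Real.pi ^ 2) ≤ δ₀ / 128 := by
    have hnum : 4 * (c₁ * C₀sq ^ 3 * Kρ ^ 5 * CA * Λ₁ * κ * ξ) ≤ δ₀ := by
      have := mul_le_mul_of_nonneg_right hξb hδ₀.le
      have e : ξ * (4 * c₁ * C₀sq ^ 3 * Kρ ^ 5 * CA * Λ₁ * κ / δ₀) * δ₀ =
          4 * (c₁ * C₀sq ^ 3 * Kρ ^ 5 * CA * Λ₁ * κ * ξ) := by field_simp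
      rw [e, one_mul] at this
      exact this
    rw [div_le_div_iff₀ (by positivity) (by norm_num)]
    have h : 0 ≤ δ₀ * (Real.pi ^ 2 - 1) := mul_nonneg hδ₀.le (sub_nonneg.2 hπ2)
    linarith only [hnum, h]
  have hS4b : c₁ * C₀sq ^ 3 * Kρ ^ 5 * CA * Λ₁ / (32 * Real.pi ^ 2 * κ) ≤ δ₀ / 128 := by
    have hκa' := hκa
    rw [div_le_iff₀ hδ₀] at hκa'
    rw [div_le_div_iff₀ (by positivity) (by norm_num)]
    have h : 0 ≤ κ * δ₀ * (Real.pi ^ 2 - 1) := mul_nonneg (mul_nonneg hκ0.le hδ₀.le) (sub_nonneg.2 hπ2)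
    linarith only [hκa', h]
  have hS4c : 512 * c₁ * C₀sq * Λ₁ / δ₀ * Real.exp (-(1 / 2)) * Real.exp (-(Kρ ^ 2 / (16 * Λ₁))) * CG ≤
      δ₀ / 112 := by
    have ht : Real.exp (-(Kρ ^ 2 / (16 * Λ₁))) ≤ 1 / (Kρ ^ 2 / (16 * Λ₁)) :=
      hexpinv _ (by positivity)
    have he : Real.exp (-(1 / 2)) ≤ 1 := Real.exp_le_one_iff.2 (by norm_num)
    have h1 : 512 * c₁ * C₀sq * Λ₁ / δ₀ * Real.exp (-(1 / 2)) * Real.exp (-(Kρ ^ 2 / (16 * Λ₁))) * CG ≤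
        512 * c₁ * C₀sq * Λ₁ / δ₀ * 1 * (1 / (Kρ ^ 2 / (16 * Λ₁))) * CG := by
      gcongr
    rw [alg_e4d c₁ C₀sq Λ₁ δ₀ Kρ CG hδne hKne hΛne] at h1
    have h2 : 8192 * c₁ * C₀sq * Λ₁ ^ 2 * CG / (δ₀ * Kρ ^ 2) ≤ δ₀ / 112 := by
      rw [div_le_div_iff₀ (by positivity) (by norm_num)]
      have hKb' := hKb
      rw [alg_e4e c₁ C₀sq Λ₁ δ₀ CG hδne, div_le_iff₀ (by positivity)] at hKb'
      have h : Kρ * (δ₀ * δ₀) ≤ Kρ ^ 2 * (δ₀ * δ₀) := mul_le_mul_of_nonneg_right hK2 (by positivity)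
      linarith only [hKb', h]
    linarith only [h1, h2]
  -- sum
  have hsplit : (KH / 4
    + c₂ / g ^ 2 *
      ((1 / (4 * Real.pi * (g ^ 2 / C₀sq)) ^ 2) * (ξ * (CA * (Kρ * g) ^ 4)) +
        4 * Real.exp (-(Kρ * g) ^ 2 / (8 * (Λ₁ * g ^ 2))) * CG)
    + c₁ / g * ((1 / 2) * KH + (1 / (2 * 1)) * CG)
    + (1 / (g ^ 2 / C₀sq)) * (c₁ / g *
      ((1 / (4 * Real.pi * (g ^ 2 / C₀sq)) ^ 2) * (Kρ * g) *
          ((κ / 2) * (ξ * (CA * (Kρ * g) ^ 4)) + CA * (Kρ * g) ^ 4 / (2 * κ))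
        + 32 * Real.sqrt (Λ₁ * g ^ 2) * Real.exp (-(1 / 2)) *
          Real.exp (-(Kρ * g) ^ 2 / (16 * (Λ₁ * g ^ 2))) * CG)))
    * (Λ₁ * g ^ 2) =
    KH / 4 * (Λ₁ * g ^ 2)
    + (c₂ / g ^ 2 * ((1 / (4 * Real.pi * (g ^ 2 / C₀sq)) ^ 2) * (ξ * (CA * (Kρ * g) ^ 4))) * (Λ₁ * g ^ 2)
      + c₂ / g ^ 2 * (4 * Real.exp (-(Kρ * g) ^ 2 / (8 * (Λ₁ * g ^ 2))) * CG) * (Λ₁ * g ^ 2))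
    + c₁ / g * ((1 / 2) * KH + (1 / (2 * 1)) * CG) * (Λ₁ * g ^ 2)
    + ((1 / (g ^ 2 / C₀sq)) * (c₁ / g * ((1 / (4 * Real.pi * (g ^ 2 / C₀sq)) ^ 2) * (Kρ * g) *
        ((κ / 2) * (ξ * (CA * (Kρ * g) ^ 4)) + CA * (Kρ * g) ^ 4 / (2 * κ)))) * (Λ₁ * g ^ 2)
      + (1 / (g ^ 2 / C₀sq)) * (c₁ / g * (32 * Real.sqrt (Λ₁ * g ^ 2) * Real.exp (-(1 / 2)) *
        Real.exp (-(Kρ * g) ^ 2 / (16 * (Λ₁ * g ^ 2))) * CG)) * (Λ₁ * g ^ 2)) := by ring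
  rw [hsplit, alg_e2a c₂ g C₀sq ξ CA Kρ Λ₁ hg0 hCne, alg_e4a g C₀sq c₁ Kρ κ ξ CA Λ₁ hg0 hCne hκne, hsqrt,
    alg_e2b Kρ g Λ₁ hg0 hΛne 16 (by norm_num),
    alg_e4b g C₀sq c₁ (Real.exp (-(1 / 2))) (Real.exp (-(Kρ ^ 2 / (16 * Λ₁)))) CG Λ₁ δ₀ hg0 hCne hδne]
  linarith only [hS1, hS2a, hS2b, hS3, hS4a, hS4b, hS4c, hδ₀]

end Summit.SmoothPoincare4.SmoothPoincare4.Cruxes.CylinderRungTwo.KillingFlux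

end
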